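import Summits.QuantumAdvantage.QuantumAdvantage.Theorems.CubicForrelationNearExactIsExactTwoModSixPrep

/-!
# Crux `CubicForrelation.NearExactIsExact` (stmt-QuantumAdvantage-14043) — two-sided analysis on `n = 6r + 4` bits (general `r`):
  Parseval, budget, pairing, and the tower above the split level

Certificate seat `b2b-cforr-cert` (gen 6).  HONEST FRAMING: preparatory lemmas, uniform in `r`, for the theorem that on `n ≡ 4 (mod 6)` bits the
boundary value `1 − 2^{−⌊n/3⌋−1}` of the uniform one-sided rate (`isolation_rate`) is never attained — infinitely many finite-slice verdicts,
NOT summit progress (the rate tends to `1`; at `n = 16` the tree's bound `31/32` is already better than this boundary `63/64`).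

With `m = 3r+2`, `W_g = 2^{2r+2}·u` (Ax), `s = (−1)^f`, `τ = u − 2^r s` (a bent `g` has `|u| = 2^r`):
* `fms_sum_u_sq`: `Σ u² = 2^{8r+4}`;  `fms_sum_su`: `Σ (−1)^f u = 2^{7r+4} Φ`;  `fms_budget`: `Σ (u − 2^r s)² = 2^{8r+5}(1 − Φ)`;
  `fms_pairing`: `Σ_y (−1)^g τ̂(y) = 2^{10r+6}(1 − Φ)`;
* `fms_high_levels`: for `r ≥ 2`, `W_g ∈ 2^{2r+3}ℤ` and `Φ ≥ 1 − 2^{−(2r+2)}` force `Φ = 1` (`tms_walk_from` with cost exponent `2r+1`).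

References: J. Ax (1964) / R. J. McEliece (1972); X.-D. Hou (1998); R. O'Donnell (2014) §3.3.  Everything below is proved from Mathlib and the
tree; axioms are the standard three.
-/

set_option linter.dupNamespace false -- D-0017: single-problem summit ⇒ `QuantumAdvantage.QuantumAdvantage` by design

noncomputable section

namespace Summit.QuantumAdvantage.QuantumAdvantage.Theorems.CubicForrelation.NearExactIsExact

open Finset
open Literature.Computability.QuantumComplexity
open Literature.Computability.QuantumComplexity.DerivativeWalsh (W)

/-- Parseval at the Ax level on `6r+4` bits: `W_g = 2^{2r+2}u ⇒ Σ_x u(x)² = 2^{8r+4}`. [folklore] -/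
theorem fms_sum_u_sq (r : ℕ) (g : (Fin ((3 * r + 2) + (3 * r + 2)) → Bool) → Bool) (u : (Fin ((3 * r + 2) + (3 * r + 2)) → Bool) → ℤ)
    (hu : ∀ x, W (fun y => signOf (g y)) x = (2 : ℝ) ^ (2 * r + 2) * (u x : ℝ)) : ∑ x, ((u x : ℝ)) ^ 2 = (2 : ℝ) ^ (8 * r + 4) := by
  have hP := DerivativeWalsh.sum_W_sq (fun y => signOf (g y))
  have h1 : ∀ b : Bool, signOf b ^ 2 = (1 : ℝ) := fun b => by unfold signOf; split_ifs <;> norm_num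
  have hL : ∑ x, W (fun y => signOf (g y)) x ^ 2 = (2 : ℝ) ^ (4 * r + 4) * ∑ x, (u x : ℝ) ^ 2 := by
    rw [mul_sum]
    refine sum_congr rfl fun x _ => ?_
    rw [hu x]; ring
  rw [hL, sum_congr rfl fun y _ => h1 _, sum_const, card_univ, Fintype.card_fun, Fintype.card_bool, Fintype.card_fin,
    nsmul_eq_mul, mul_one] at hP
  push_cast at hP
  have e : ((2 : ℝ) ^ ((3 * r + 2) + (3 * r + 2))) * 2 ^ ((3 * r + 2) + (3 * r + 2)) = 2 ^ (4 * r + 4) * 2 ^ (8 * r + 4) := by ring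
  rw [e] at hP
  exact mul_left_cancel₀ (by positivity) hP

/-- `Σ_x (−1)^{f(x)} u(x) = 2^{7r+4}·Φ(f,g)` on `6r+4` bits with `W_g = 2^{2r+2}u`. [folklore] -/
theorem fms_sum_su (r : ℕ) (f g : (Fin ((3 * r + 2) + (3 * r + 2)) → Bool) → Bool) (u : (Fin ((3 * r + 2) + (3 * r + 2)) → Bool) → ℤ)
    (hu : ∀ x, W (fun y => signOf (g y)) x = (2 : ℝ) ^ (2 * r + 2) * (u x : ℝ)) :
    ∑ x, signOf (f x) * (u x : ℝ) = (2 : ℝ) ^ (7 * r + 4) * forrelation f g := by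
  have hΦ := vg_two_pow_mul_forrelation f g
  have e : ∑ x, signOf (f x) * W (fun y => signOf (g y)) x = (2 : ℝ) ^ (2 * r + 2) * ∑ x, signOf (f x) * (u x : ℝ) := by
    rw [mul_sum]; exact sum_congr rfl fun x _ => by rw [hu x]; ring
  rw [e, show 3 * (3 * r + 2) = (2 * r + 2) + (7 * r + 4) by ring, pow_add, mul_assoc] at hΦ
  exact (mul_left_cancel₀ (by positivity) hΦ).symm

/-- **Two-sided budget on `6r+4` bits.** `Σ_x (u − 2^r s)² = 2^{8r+5}·(1 − Φ(f,g))`. [this work] -/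
theorem fms_budget (r : ℕ) (f g : (Fin ((3 * r + 2) + (3 * r + 2)) → Bool) → Bool) (u : (Fin ((3 * r + 2) + (3 * r + 2)) → Bool) → ℤ)
    (hu : ∀ x, W (fun y => signOf (g y)) x = (2 : ℝ) ^ (2 * r + 2) * (u x : ℝ)) :
    ((∑ x, (u x - 2 ^ r * sZ (f x)) ^ 2 : ℤ) : ℝ) = (2 : ℝ) ^ (8 * r + 5) * (1 - forrelation f g) := by
  have hsq := fms_sum_u_sq r g u hu
  have hsu := fms_sum_su r f g u hu
  have hL : ((∑ x, (u x - 2 ^ r * sZ (f x)) ^ 2 : ℤ) : ℝ) =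
      ∑ x, ((u x : ℝ) ^ 2 - 2 * 2 ^ r * (signOf (f x) * (u x : ℝ)) + ((2 : ℝ) ^ r) ^ 2) := by
    push_cast
    refine sum_congr rfl fun x _ => ?_
    rw [tp_sZ_cast]
    linear_combination ((2 : ℝ) ^ r) ^ 2 * BuzetChailloux.signOf_sq (f x)
  rw [hL, sum_add_distrib, sum_sub_distrib, ← mul_sum, hsq, hsu, sum_const, card_univ, Fintype.card_fun, Fintype.card_bool,
    Fintype.card_fin, nsmul_eq_mul]
  push_cast
  ring

/-- **The two-sided pairing identity on `6r+4` bits.** `Σ_y (−1)^{g(y)}·(u − 2^r(−1)^f)^(y) = 2^{10r+6}·(1 − Φ(f,g))`. [this work] -/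
theorem fms_pairing (r : ℕ) (f g : (Fin ((3 * r + 2) + (3 * r + 2)) → Bool) → Bool) (u : (Fin ((3 * r + 2) + (3 * r + 2)) → Bool) → ℤ)
    (hu : ∀ x, W (fun y => signOf (g y)) x = (2 : ℝ) ^ (2 * r + 2) * (u x : ℝ)) :
    ∑ y, signOf (g y) * W (fun x => (u x : ℝ) - (2 : ℝ) ^ r * signOf (f x)) y = (2 : ℝ) ^ (10 * r + 6) * (1 - forrelation f g) := by
  rw [fl1_pairing]
  have hsq := fms_sum_u_sq r g u hu
  have hsu := fms_sum_su r f g u hu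
  have e : ∀ x, ((u x : ℝ) - (2 : ℝ) ^ r * signOf (f x)) * W (fun y => signOf (g y)) x =
      (2 : ℝ) ^ (2 * r + 2) * (u x : ℝ) ^ 2 - 2 ^ (2 * r + 2) * 2 ^ r * (signOf (f x) * (u x : ℝ)) := by
    intro x; rw [hu x]; ring
  rw [sum_congr rfl fun x _ => e x, sum_sub_distrib, ← mul_sum, ← mul_sum, hsq, hsu]
  ring

/-- **The levels above the split level on `6r+4` bits (`r ≥ 2`).**  If `W_g ∈ 2^{2r+3}ℤ` and `Φ(f,g) ≥ 1 − 2^{−(2r+2)}` then `Φ(f,g) = 1`: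
every level `≥ 2r+3` of the tower costs at least `2^{−(2r+1)}`, and a bent `g` gives `Φ = 1` or `Φ ≤ 1 − 2^{1−⌊(3r+5)/2⌋} < 1 − 2^{−(2r+2)}`.
[this work] -/
theorem fms_high_levels (r : ℕ) (hr : 2 ≤ r) (f g : (Fin ((3 * r + 2) + (3 * r + 2)) → Bool) → Bool) (hf : IsDegLeFun 3 f)
    (hg : IsDegLeFun 3 g) (w : (Fin ((3 * r + 2) + (3 * r + 2)) → Bool) → ℤ)
    (hw : ∀ x, W (fun y => signOf (g y)) x = (2 : ℝ) ^ (2 * r + 3) * (w x : ℝ))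
    (hΦ : 1 - (1 / 2 : ℝ) ^ (2 * r + 2) ≤ forrelation f g) : forrelation f g = 1 := by
  rcases tms_walk_from (3 * r + 2) (2 * r + 3) (2 * r + 1) g hg (by omega) (by omega) w hw (by intro j hj hjm; omega) (by omega)
    with hbent | hcap
  · rcases tw_bent_end (by omega) f g hf hg hbent with h | h
    · exact h
    · exfalso
      have hlt : (1 / 2 : ℝ) ^ (2 * r + 2) < 2 / 2 ^ ((3 * r + 2 + 3) / 2) := by
        have e : (2 : ℝ) / 2 ^ ((3 * r + 2 + 3) / 2) = (1 / 2) ^ ((3 * r + 2 + 3) / 2 - 1) := by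
          obtain ⟨a, ha⟩ : ∃ a, (3 * r + 2 + 3) / 2 = a + 1 := ⟨(3 * r + 2 + 3) / 2 - 1, by omega⟩
          rw [ha, pow_succ, one_div_pow, Nat.add_sub_cancel]
          field_simp
        rw [e]
        exact pow_lt_pow_right_of_lt_one₀ (by norm_num) (by norm_num) (by omega)
      linarith
  · exfalso
    have := tw_forrelation_le_of_cap f g hcap
    have hlt : (1 / 2 : ℝ) ^ (2 * r + 2) < (1 / 2) ^ (2 * r + 1) := pow_lt_pow_right_of_lt_one₀ (by norm_num) (by norm_num) (by omega)
    linarith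

end Summit.QuantumAdvantage.QuantumAdvantage.Theorems.CubicForrelation.NearExactIsExact

end
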